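import Summits.NavierStokesRegularity.FluidComputer.PalasekTowerEpisodes
import Literature.Analysis.FluidPDE.ClassicalLocalEnergyCutoff
import Literature.Analysis.FluidPDE.ClassicalSuitableRegion
import Literature.Analysis.FluidPDE.TaoForcedUniquenessClayForce
import Literature.Analysis.FluidPDE.NSVorticityBKMEnergy
import Literature.Analysis.FluidPDE.ClassicalSolutionGalilean
import Literature.Analysis.FluidPDE.PeriodicLerayProfileGradient

/-!
# No energy teleportation: local energies of a bounded classical Clay flow are Lipschitz in time,
# UNIFORMLY in the centre of the cut-off

Cell `ns-blowup`, seat `ns-blowup-fc-prover-3` (g2; prover; D-0074 GROUP C/E «BRIDGE SUPPORT»;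
bears_on LADDER-NS N1, route `PalasekTowerBreakdown`, items stmt-NavierStokesRegularity-19249 /
19250 / 19178 — supports only, nothing claimed). LABEL: E–C typing (KERNEL analysis; every statement
PROVED; no `Prop` introduced; the one Literature fact used is the PROVED a.e. pressure normalisation
`tao2011_forced_pressure_normalisation_ae_holds`). WHAT THIS IS NOT: not Navier–Stokes evidence —
an a-priori estimate valid for EVERY classical finite-energy solution with a bounded velocity, a
bounded velocity gradient and a Clay-class force; nothing is constructed.

## Statement (`localEnergy_lipschitz_uniform`)

Let `(u, p)` be a classical solution of the forced system on `[0, T] × ℝ³` (`ν > 0`, `T > 0`) with a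
Clay-class force `f` (smooth on `[0, ∞) × ℝ³`, Fefferman decay (5)), finite energy
`∫|u(t)|² ≤ E₀`, `‖u‖ ≤ M` and `‖Du‖ ≤ B` on the slab. Then for every test function `φ ∈ C_c^∞(ℝ³)`
there is ONE constant `K` such that for EVERY centre `a` and all `t, t' ∈ [0, T]`

`|∫ φ(x + a) |u(t, x)|² dx − ∫ φ(x + a) |u(t', x)|² dx| ≤ K |t − t'|`.

In words: kinetic energy cannot appear in (or leave) a unit region faster than at rate `K`, wherever
the region is. Proof: the local energy identity against the translated cut-off
(`IsClassicalNSSolutionOn.hasDerivAt_integral_cutoff_norm_sq`, `integral_energy_flux_eq_of_momentum`)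
gives `d/dt ∫φ_a|u|² = ∫(νΔφ_a|u|² + Dφ_a(u)|u|² + 2pDφ_a(u) + 2φ_a⟪f,u⟫) − 2ν∫|Du|²_F φ_a` on
`(0, T)`; the transport, viscous, force and dissipation terms are bounded by `M`, `B`, the sup of
`f` (`clayForce_slice_sup_integrable`) and the `L¹` norms of `φ, Dφ, Δφ` (translation invariant);
the PRESSURE term is bounded at almost every time by Tao's normalisation
`p = Q[u] + Φ[f] + C(t)` (a.e. `t`, PROVED in the tree): the constant `C(t)` integrates to zero
against the divergence-free `Dφ_a(u)`, and `Q[u]`, `Φ[f]` are in `L²` uniformly in `t`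
(`integral_normalisedPressure_sq_le_of_bound`, `clayForce_slice_potential_bounds`), so
`|∫ 2pDφ_a(u)| ≤ ∫Q² + ∫Φ² + 2M²∫|Dφ|²`; the derivative being continuous on `(0, T)`, the a.e. bound
is an everywhere bound, and the mean value theorem on `[0, T]` (where `t ↦ ∫φ_a|u(t)|²` is
continuous) concludes.

Consumed by `PalasekTowerStageTightness.lean` (this seat): for a registered stage (`M = c₂Y_k`,
`B` from `Stage.exists_norm_fderiv_le`) speed `≥ L` at points escaping to infinity would put energy
`≥ δ(L)` in unit balls escaping to infinity at nearby times, hence — by this lemma — at ONE time,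
contradicting finite energy: the super-level sets `{‖u‖ ≥ L}` of the slab are bounded, which is the
hypothesis `hdec` of `PalasekTowerWindowFirstHitting.lean`.

References: L. Caffarelli, R. Kohn, L. Nirenberg, CPAM 35 (1982) §2 (2.5) (local energy identity)
[cite: CaffarelliKohnNirenberg1982, §2 (2.5)]; T. Tao, Anal. PDE 6 (2013), Lemma 4.1 (i)
[cite: Tao2011, Lemma 4.1 (i)]; C. L. Fefferman, Clay problem description, (5)
[cite: FeffermanClay2006, (5)].
-/

noncomputable section

namespace Summit.NavierStokesRegularity.FluidComputer.PalasekTowerClayBridge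

open Set MeasureTheory Filter Topology Function Real
open scoped ENNReal ContDiff NNReal InnerProductSpace RealInnerProductSpace
open Laplacian
open Literature.Analysis.FluidPDE

namespace LocalEnergy

/-! ## §1 Real-variable helpers -/

/-- A nonnegative-square bookkeeping step: a finite `∫⁻ ‖g‖ₑ²` gives an integrable `‖g‖²` with the
corresponding real bound. [folklore] -/
theorem integrable_sq_of_lintegral_le {X : Type*} [MeasurableSpace X] {μ : Measure X}
    {F : Type*} [NormedAddCommGroup F] {g : X → F} (hg : AEStronglyMeasurable g μ) {C : ℝ≥0∞}
    (hC : C ≠ ⊤) (h : ∫⁻ x, ‖g x‖ₑ ^ 2 ∂μ ≤ C) :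
    Integrable (fun x => ‖g x‖ ^ 2) μ ∧ ∫ x, ‖g x‖ ^ 2 ∂μ ≤ C.toReal := by
  have e : ∀ x, ‖‖g x‖ ^ 2‖ₑ = ‖g x‖ₑ ^ 2 := fun x => by
    rw [Real.enorm_eq_ofReal (sq_nonneg _), ← ofReal_norm, ENNReal.ofReal_pow (norm_nonneg _)]
  have hlt : ∫⁻ x, ‖‖g x‖ ^ 2‖ₑ ∂μ < ⊤ := by
    simp_rw [e]; exact lt_of_le_of_lt h hC.lt_top
  have hint : Integrable (fun x => ‖g x‖ ^ 2) μ := ⟨(hg.norm.pow 2), hlt⟩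
  refine ⟨hint, ?_⟩
  rw [integral_eq_lintegral_of_nonneg_ae (Eventually.of_forall fun x => sq_nonneg _)
    hint.aestronglyMeasurable]
  have h' : ∫⁻ x, ENNReal.ofReal (‖g x‖ ^ 2) ∂μ ≤ C := by
    refine le_trans (le_of_eq (lintegral_congr fun x => ?_)) h
    rw [← ofReal_norm, ENNReal.ofReal_pow (norm_nonneg _)]
  exact ENNReal.toReal_mono hC h'

/-- A continuous real function on an open set which is bounded by `K` almost everywhere is bounded
by `K` everywhere (nonempty open sets of `ℝ` have positive Lebesgue measure). [folklore] -/
theorem forall_abs_le_of_ae {g : ℝ → ℝ} {U : Set ℝ} (hU : IsOpen U) (hg : ContinuousOn g U) {K : ℝ}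
    (hK : ∀ᵐ t ∂volume, t ∈ U → |g t| ≤ K) : ∀ t ∈ U, |g t| ≤ K := by
  intro t ht
  by_contra hlt
  have hlt' : K < |g t| := lt_of_not_ge hlt
  set V : Set ℝ := U ∩ (fun s => |g s|) ⁻¹' Ioi K with hV
  have hVo : IsOpen V := (hg.abs).isOpen_inter_preimage hU isOpen_Ioi
  have htV : t ∈ V := ⟨ht, hlt'⟩
  have hpos : 0 < volume V := hVo.measure_pos volume ⟨t, htV⟩
  have hzero : volume V = 0 := by
    refine measure_mono_null (fun s hsV => ?_) (ae_iff.1 hK)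
    exact fun himp => absurd (himp hsV.1) (not_le.2 hsV.2)
  exact absurd hzero hpos.ne'

/-! ## §2 The translated cut-off -/

variable {φ : EuclideanSpace ℝ (Fin 3) → ℝ}

/-- The translate `x ↦ φ (x + a)` of a smooth function is smooth. [folklore] -/
theorem contDiff_translate (hφ : ContDiff ℝ ∞ φ) (a : EuclideanSpace ℝ (Fin 3)) :
    ContDiff ℝ ∞ fun x => φ (x + a) :=
  hφ.comp (contDiff_id.add contDiff_const)

/-- The translate of a compactly supported function is compactly supported. [folklore] -/
theorem hasCompactSupport_translate (hφc : HasCompactSupport φ) (a : EuclideanSpace ℝ (Fin 3)) :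
    HasCompactSupport fun x => φ (x + a) :=
  hφc.comp_homeomorph (Homeomorph.addRight a)

/-- Derivative of the translate: `D(φ(· + a))(x) = Dφ(x + a)`. [folklore] -/
theorem fderiv_translate (a x : EuclideanSpace ℝ (Fin 3)) :
    fderiv ℝ (fun y => φ (y + a)) x = fderiv ℝ φ (x + a) :=
  fderiv_comp_add_right a

/-- Laplacian of the translate: `Δ(φ(· + a))(x) = Δφ(x + a)`. [folklore] -/
theorem laplacian_translate (a x : EuclideanSpace ℝ (Fin 3)) :
    (Δ (fun y => φ (y + a))) x = (Δ φ) (x + a) :=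
  laplacian_comp_add_right φ a x

/-- The Laplacian of a `C²` function is continuous. [folklore] -/
theorem continuous_laplacian (hφ : ContDiff ℝ 2 φ) : Continuous (Δ φ) := by
  rw [InnerProductSpace.laplacian_eq_iteratedFDeriv_stdOrthonormalBasis]
  refine continuous_finsetSum _ fun i _ => ?_
  exact (hφ.continuous_iteratedFDeriv le_rfl).eval_const _

/-- The Laplacian of a compactly supported function is compactly supported. [folklore] -/
theorem hasCompactSupport_laplacian (hφc : HasCompactSupport φ) : HasCompactSupport (Δ φ) :=
  HasCompactSupport.of_support_subset_isCompact hφc.isCompact fun y hy => by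
    by_contra h
    exact hy (laplacian_eq_zero_of_notMem_tsupport h)

/-- Translation invariance of the Lebesgue integral, in the form used below:
`∫ g(x + a) dx = ∫ g`. [folklore] -/
theorem integral_translate (g : EuclideanSpace ℝ (Fin 3) → ℝ) (a : EuclideanSpace ℝ (Fin 3)) :
    ∫ x, g (x + a) = ∫ x, g x :=
  integral_add_right_eq_self g a


/-- Squares of compactly supported real functions are compactly supported. [folklore] -/
theorem hasCompactSupport_sq {h : EuclideanSpace ℝ (Fin 3) → ℝ} (hh : HasCompactSupport h) :
    HasCompactSupport fun x => h x ^ 2 := by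
  have h2 : HasCompactSupport (h * h) := hh.mul_right
  have e : (fun x => h x ^ 2) = h * h := by funext x; simp [sq]
  rw [e]; exact h2

/-! ## §3 The flux bound at one time -/

/-- **The local energy flux at a fixed time is bounded by data that do not see the centre of the
cut-off.** At a time where the momentum equation holds pointwise with a velocity `U` (`C²`, divergence
free, `‖U‖ ≤ M`, `‖DU‖ ≤ B`, `∫|U|² ≤ E₀`), a force `F` (`‖F‖ ≤ M_f`) and a pressure that IS
NORMALISED, `P = Q[U] + Φ + c` with `∫ Φ² ≤ P_Φ`, the pairing `∫ ψ · 2⟪U, ∂ₜU⟫` against a test function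
`ψ` is bounded by
`ν M² ∫|Δψ| + M³ ∫‖Dψ‖ + ((27M_λ)² M² E₀ + P_Φ + 2 M² ∫‖Dψ‖²) + 2 M_f M ∫|ψ| + 6 ν B² ∫|ψ|`
(local energy identity; the constant `c` pairs to zero with the divergence-free `Dψ(U)`; Cauchy–Schwarz
in the form `2|Qg| ≤ Q² + g²`). [cite: CaffarelliKohnNirenberg1982, §2 (2.5)] -/
theorem abs_flux_le {ν : ℝ} (hν : 0 ≤ ν) {U F D : EuclideanSpace ℝ (Fin 3) → EuclideanSpace ℝ (Fin 3)}
    {P Φ ψ : EuclideanSpace ℝ (Fin 3) → ℝ} {c : ℝ}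
    (hU : ContDiff ℝ ∞ U) (hP : ContDiff ℝ 1 P) (hD : Continuous D) (hF : Continuous F)
    (hmom : ∀ x, D x + convect U U x = ν • (Δ U) x - gradient P x + F x)
    (hdiv : VectorCalculus.IsDivFree U)
    {M B Mf E₀ PΦ : ℝ} (hM : ∀ x, ‖U x‖ ≤ M) (hB : ∀ x, ‖fderiv ℝ U x‖ ≤ B) (hMf : ∀ x, ‖F x‖ ≤ Mf)
    (hUi : Integrable fun x => ‖U x‖ ^ 2) (hUE : ∫ x, ‖U x‖ ^ 2 ≤ E₀)
    (hPn : ∀ x, P x = normalisedPressure U x + Φ x + c)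
    (hΦm : AEStronglyMeasurable Φ volume) (hΦi : Integrable fun x => Φ x ^ 2)
    (hΦE : ∫ x, Φ x ^ 2 ≤ PΦ)
    (hψ : ContDiff ℝ ∞ ψ) (hψc : HasCompactSupport ψ) :
    |∫ x, ψ x * (2 * ⟪U x, D x⟫)| ≤
      ν * M ^ 2 * (∫ x, |(Δ ψ) x|) + M ^ 3 * (∫ x, ‖fderiv ℝ ψ x‖) +
        ((27 * regLaplacianMass) ^ 2 * (M ^ 2 * E₀) + PΦ + 2 * (M ^ 2 * ∫ x, ‖fderiv ℝ ψ x‖ ^ 2)) +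
        2 * Mf * M * (∫ x, |ψ x|) + 6 * ν * B ^ 2 * (∫ x, |ψ x|) := by
  -- regularity
  have hU2 : ContDiff ℝ 2 U := hU.of_le (by norm_cast)
  have hU1 : ContDiff ℝ 1 U := hU.of_le (by norm_cast)
  have hUc : Continuous U := hU.continuous
  have hψ2 : ContDiff ℝ 2 ψ := hψ.of_le (by norm_cast)
  have hψ1 : ContDiff ℝ 1 ψ := hψ.of_le (by norm_cast)
  have hψcont : Continuous ψ := hψ.continuous
  have hDψc : Continuous (fderiv ℝ ψ) := hψ1.continuous_fderiv one_ne_zero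
  have hDψs : HasCompactSupport (fderiv ℝ ψ) := hψc.fderiv (𝕜 := ℝ)
  have hΔψc : Continuous (Δ ψ) := continuous_laplacian hψ2
  have hΔψs : HasCompactSupport (Δ ψ) := hasCompactSupport_laplacian hψc
  have hM0 : 0 ≤ M := (norm_nonneg _).trans (hM 0)
  have hMf0 : 0 ≤ Mf := (norm_nonneg _).trans (hMf 0)
  -- the pairing `g = Dψ(U) = ⟪U, ∇ψ⟫`
  set g : EuclideanSpace ℝ (Fin 3) → ℝ := fun x => fderiv ℝ ψ x (U x) with hg
  have hgc : Continuous g := hDψc.clm_apply hUc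
  have hgs : HasCompactSupport g := by
    refine hDψs.mono' fun x hx => subset_tsupport _ ?_
    rw [Function.mem_support] at hx ⊢
    intro h0
    exact hx (by simp only [hg, h0, zero_apply])
  have hg_le : ∀ x, |g x| ≤ ‖fderiv ℝ ψ x‖ * M := fun x =>
    (Real.norm_eq_abs _ ▸ (fderiv ℝ ψ x).le_opNorm (U x)).trans
      (mul_le_mul_of_nonneg_left (hM x) (norm_nonneg _))
  have hgi : Integrable g := hgc.integrable_of_hasCompactSupport hgs
  have hg0 : ∫ x, g x = 0 := by
    have h := integral_inner_gradient_eq_zero_of_divergence_eq_zero hU1 hψ1 hψc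
      (fun x _ => hdiv x)
    rw [← h]
    refine integral_congr_ae (Eventually.of_forall fun x => ?_)
    show fderiv ℝ ψ x (U x) = ⟪U x, gradient ψ x⟫
    rw [real_inner_comm, inner_gradient_left]
  -- the four flux integrands and the dissipation
  set A : EuclideanSpace ℝ (Fin 3) → ℝ := fun x => ν * ((Δ ψ) x * ‖U x‖ ^ 2) with hA
  set Bt : EuclideanSpace ℝ (Fin 3) → ℝ := fun x => g x * ‖U x‖ ^ 2 with hBt
  set Ct : EuclideanSpace ℝ (Fin 3) → ℝ := fun x => 2 * (P x * g x) with hCt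
  set Dt : EuclideanSpace ℝ (Fin 3) → ℝ := fun x => 2 * (ψ x * ⟪F x, U x⟫) with hDt
  have iA : Integrable A :=
    ((continuous_const.mul (hΔψc.mul (hUc.norm.pow 2))).integrable_of_hasCompactSupport
      ((hΔψs.mul_right).mul_left))
  have iBt : Integrable Bt :=
    (hgc.mul (hUc.norm.pow 2)).integrable_of_hasCompactSupport hgs.mul_right
  have iCt : Integrable Ct :=
    (continuous_const.mul (hP.continuous.mul hgc)).integrable_of_hasCompactSupport
      (hgs.mul_left.mul_left)
  have iDt : Integrable Dt :=
    (continuous_const.mul (hψcont.mul (hF.inner hUc))).integrable_of_hasCompactSupport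
      (hψc.mul_right.mul_left)
  -- the slice balance
  have key := integral_energy_flux_eq_of_momentum hU2 hP hD hF hmom hdiv hψ2 hψc
  have iAB : Integrable (fun x => A x + Bt x) := iA.add iBt
  have iABC : Integrable (fun x => A x + Bt x + Ct x) := iAB.add iCt
  have hsplit : ∫ x, (A x + Bt x + Ct x + Dt x) =
      (∫ x, A x) + (∫ x, Bt x) + (∫ x, Ct x) + ∫ x, Dt x := by
    rw [integral_add iABC iDt, integral_add iAB iCt, integral_add iA iBt]
  have hflux : ∫ x, ψ x * (2 * ⟪U x, D x⟫) =
      (∫ x, A x) + (∫ x, Bt x) + (∫ x, Ct x) + (∫ x, Dt x) -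
        2 * ν * ∫ x, frobeniusNormSq (fderiv ℝ U x) * ψ x := by
    have e : (fun x => ν * ((Δ ψ) x * ‖U x‖ ^ 2) + fderiv ℝ ψ x (U x) * ‖U x‖ ^ 2 +
        2 * (P x * fderiv ℝ ψ x (U x)) + 2 * (ψ x * ⟪F x, U x⟫)) =
        fun x => A x + Bt x + Ct x + Dt x := by
      funext x; rfl
    rw [e, hsplit] at key
    linarith
  -- term bounds
  have bA : |∫ x, A x| ≤ ν * M ^ 2 * ∫ x, |(Δ ψ) x| := by
    have hb : ∀ x, ‖A x‖ ≤ ν * M ^ 2 * |(Δ ψ) x| := fun x => by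
      have h1 : ‖U x‖ ^ 2 ≤ M ^ 2 := pow_le_pow_left₀ (norm_nonneg _) (hM x) 2
      have h2 : 0 ≤ |(Δ ψ) x| := abs_nonneg _
      rw [Real.norm_eq_abs]
      show |ν * ((Δ ψ) x * ‖U x‖ ^ 2)| ≤ _
      rw [abs_mul, abs_mul, abs_of_nonneg hν, abs_of_nonneg (sq_nonneg ‖U x‖)]
      have h3 : |(Δ ψ) x| * ‖U x‖ ^ 2 ≤ |(Δ ψ) x| * M ^ 2 := mul_le_mul_of_nonneg_left h1 h2
      nlinarith [mul_le_mul_of_nonneg_left h3 hν]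
    have hi : Integrable fun x => ν * M ^ 2 * |(Δ ψ) x| :=
      (hΔψc.abs.integrable_of_hasCompactSupport hΔψs.abs).const_mul _
    have h := norm_integral_le_of_norm_le hi (Eventually.of_forall hb)
    have e : ∫ x, ν * M ^ 2 * |(Δ ψ) x| = ν * M ^ 2 * ∫ x, |(Δ ψ) x| := integral_const_mul _ _
    rw [e, Real.norm_eq_abs] at h
    exact h
  have bBt : |∫ x, Bt x| ≤ M ^ 3 * ∫ x, ‖fderiv ℝ ψ x‖ := by
    have hb : ∀ x, ‖Bt x‖ ≤ M ^ 3 * ‖fderiv ℝ ψ x‖ := fun x => by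
      have h1 : ‖U x‖ ^ 2 ≤ M ^ 2 := pow_le_pow_left₀ (norm_nonneg _) (hM x) 2
      have h2 := hg_le x
      have h3 : 0 ≤ ‖fderiv ℝ ψ x‖ := norm_nonneg _
      rw [Real.norm_eq_abs]
      show |g x * ‖U x‖ ^ 2| ≤ _
      rw [abs_mul, abs_of_nonneg (sq_nonneg ‖U x‖)]
      calc |g x| * ‖U x‖ ^ 2 ≤ (‖fderiv ℝ ψ x‖ * M) * M ^ 2 :=
            mul_le_mul h2 h1 (sq_nonneg _) (mul_nonneg h3 hM0)
        _ = M ^ 3 * ‖fderiv ℝ ψ x‖ := by ring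
    have hi : Integrable fun x => M ^ 3 * ‖fderiv ℝ ψ x‖ :=
      (hDψc.norm.integrable_of_hasCompactSupport hDψs.norm).const_mul _
    have h := norm_integral_le_of_norm_le hi (Eventually.of_forall hb)
    have e : ∫ x, M ^ 3 * ‖fderiv ℝ ψ x‖ = M ^ 3 * ∫ x, ‖fderiv ℝ ψ x‖ := integral_const_mul _ _
    rw [e, Real.norm_eq_abs] at h
    exact h
  have bDt : |∫ x, Dt x| ≤ 2 * Mf * M * ∫ x, |ψ x| := by
    have hb : ∀ x, ‖Dt x‖ ≤ 2 * Mf * M * |ψ x| := fun x => by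
      have h1 : |⟪F x, U x⟫| ≤ Mf * M :=
        (abs_real_inner_le_norm _ _).trans (mul_le_mul (hMf x) (hM x) (norm_nonneg _) hMf0)
      have h2 : 0 ≤ |ψ x| := abs_nonneg _
      rw [Real.norm_eq_abs]
      show |2 * (ψ x * ⟪F x, U x⟫)| ≤ _
      rw [abs_mul, abs_mul, abs_two]
      nlinarith
    have hi : Integrable fun x => 2 * Mf * M * |ψ x| :=
      (hψcont.abs.integrable_of_hasCompactSupport hψc.abs).const_mul _
    have h := norm_integral_le_of_norm_le hi (Eventually.of_forall hb)
    have e : ∫ x, 2 * Mf * M * |ψ x| = 2 * Mf * M * ∫ x, |ψ x| := integral_const_mul _ _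
    rw [e, Real.norm_eq_abs] at h
    exact h
  have bE : |2 * ν * ∫ x, frobeniusNormSq (fderiv ℝ U x) * ψ x| ≤ 6 * ν * B ^ 2 * ∫ x, |ψ x| := by
    have hb : ∀ x, ‖frobeniusNormSq (fderiv ℝ U x) * ψ x‖ ≤ 3 * B ^ 2 * |ψ x| := fun x => by
      rw [Real.norm_eq_abs, abs_mul, abs_of_nonneg (frobeniusNormSq_nonneg _)]
      have h1 : frobeniusNormSq (fderiv ℝ U x) ≤ 3 * B ^ 2 :=
        (BradshawTsai2017.frobeniusNormSq_le_three_mul_norm_sq _).trans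
          (by nlinarith [pow_le_pow_left₀ (norm_nonneg _) (hB x) 2])
      exact mul_le_mul_of_nonneg_right h1 (abs_nonneg _)
    have hi : Integrable fun x => 3 * B ^ 2 * |ψ x| :=
      (hψcont.abs.integrable_of_hasCompactSupport hψc.abs).const_mul _
    have h := norm_integral_le_of_norm_le hi (Eventually.of_forall hb)
    have e : ∫ x, 3 * B ^ 2 * |ψ x| = 3 * B ^ 2 * ∫ x, |ψ x| := integral_const_mul _ _
    rw [e, Real.norm_eq_abs] at h
    rw [abs_mul, abs_mul, abs_two, abs_of_nonneg hν]
    nlinarith [abs_nonneg (∫ x, frobeniusNormSq (fderiv ℝ U x) * ψ x)]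
  -- the pressure term
  have bCt : |∫ x, Ct x| ≤
      (27 * regLaplacianMass) ^ 2 * (M ^ 2 * E₀) + PΦ + 2 * (M ^ 2 * ∫ x, ‖fderiv ℝ ψ x‖ ^ 2) := by
    obtain ⟨hQi, hQE⟩ := integral_normalisedPressure_sq_le_of_bound hU hUi hUE hM
    have hQm : AEStronglyMeasurable (normalisedPressure U) volume :=
      aestronglyMeasurable_normalisedPressure_of_integrable hU hUi
    set Q := normalisedPressure U with hQ
    -- `∫ g²`
    have ig2 : Integrable fun x => g x ^ 2 :=
      (hgc.pow 2).integrable_of_hasCompactSupport (hasCompactSupport_sq hgs)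
    have hg2 : ∫ x, g x ^ 2 ≤ M ^ 2 * ∫ x, ‖fderiv ℝ ψ x‖ ^ 2 := by
      rw [← integral_const_mul]
      refine integral_mono ig2
        (((hDψc.norm.pow 2).integrable_of_hasCompactSupport
          (hasCompactSupport_sq hDψs.norm)).const_mul _)
        fun x => ?_
      have h1 := hg_le x
      have h2 : g x ^ 2 = |g x| ^ 2 := (sq_abs _).symm
      rw [h2]
      calc |g x| ^ 2 ≤ (‖fderiv ℝ ψ x‖ * M) ^ 2 := pow_le_pow_left₀ (abs_nonneg _) h1 2
        _ = M ^ 2 * ‖fderiv ℝ ψ x‖ ^ 2 := by ring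
    -- `Q g` and `Φ g` are integrable, with `|∫ R g| ≤ (∫ R² + ∫ g²)/2`
    have pair : ∀ {R : EuclideanSpace ℝ (Fin 3) → ℝ}, AEStronglyMeasurable R volume →
        Integrable (fun x => R x ^ 2) → Integrable (fun x => R x * g x) ∧
          |∫ x, R x * g x| ≤ ((∫ x, R x ^ 2) + ∫ x, g x ^ 2) / 2 := by
      intro R hRm hRi
      have hb : ∀ x, ‖R x * g x‖ ≤ (R x ^ 2 + g x ^ 2) / 2 := fun x => by
        rw [Real.norm_eq_abs, abs_mul]
        have := two_mul_le_add_sq |R x| |g x|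
        rw [sq_abs, sq_abs] at this
        linarith
      have hdom : Integrable fun x => (R x ^ 2 + g x ^ 2) / 2 := (hRi.add ig2).div_const 2
      have hRg : Integrable (fun x => R x * g x) :=
        hdom.mono' (hRm.mul hgc.aestronglyMeasurable) (Eventually.of_forall hb)
      refine ⟨hRg, ?_⟩
      have h := norm_integral_le_of_norm_le hdom (Eventually.of_forall hb)
      rw [Real.norm_eq_abs] at h
      refine h.trans (le_of_eq ?_)
      rw [integral_div, integral_add hRi ig2]
    obtain ⟨iQg, bQg⟩ := pair hQm hQi
    obtain ⟨iΦg, bΦg⟩ := pair hΦm hΦi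
    -- expand the pressure
    have i1 : Integrable (fun x => Q x * g x + Φ x * g x) := iQg.add iΦg
    have i2 : Integrable (fun x => c * g x) := hgi.const_mul c
    have hCt' : ∫ x, Ct x = 2 * ((∫ x, Q x * g x) + (∫ x, Φ x * g x) + c * ∫ x, g x) := by
      have e : Ct = fun x => 2 * (Q x * g x + Φ x * g x + c * g x) := by
        funext x; rw [hCt]; simp only [hPn x]; ring
      have e2 : ∫ x, c * g x = c * ∫ x, g x := integral_const_mul _ _
      rw [e, integral_const_mul, integral_add i1 i2, integral_add iQg iΦg, e2]
    rw [hCt', hg0, mul_zero, add_zero, abs_mul, abs_two]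
    have h3 := abs_add_le (∫ x, Q x * g x) (∫ x, Φ x * g x)
    have hg2nn : 0 ≤ ∫ x, g x ^ 2 := integral_nonneg fun x => sq_nonneg _
    nlinarith [hQE, hΦE, hg2, bQg, bΦg, hg2nn]
  -- assemble
  rw [hflux]
  have h4 := abs_add_le ((∫ x, A x) + (∫ x, Bt x) + (∫ x, Ct x)) (∫ x, Dt x)
  have h5 := abs_add_le ((∫ x, A x) + (∫ x, Bt x)) (∫ x, Ct x)
  have h6 := abs_add_le (∫ x, A x) (∫ x, Bt x)
  have h7 := abs_sub ((∫ x, A x) + (∫ x, Bt x) + (∫ x, Ct x) + (∫ x, Dt x))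
    (2 * ν * ∫ x, frobeniusNormSq (fderiv ℝ U x) * ψ x)
  linarith

end LocalEnergy

end Summit.NavierStokesRegularity.FluidComputer.PalasekTowerClayBridge

end
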